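import Mathlib.CategoryTheory.WithTerminal.Basic
import Literature.AnabelianGeometry.SemiGraphs.OncePuncturedTemperedGroupWitness
import Literature.AnabelianGeometry.EtaleTheta.Discharge.Sec4NonVacuity
import Literature.AnabelianGeometry.EtaleTheta.Discharge.Sec4Prop43ii
import HarnessLib

/-!
# [EtTh] §4: a toy setting WITH A NON-TRIVIAL GALOIS ACTION on the rational functions (data)

S. Mochizuki, *The étale theta function and its Frobenioid-theoretic manifestations*, Publ. RIMS **45**
(2009) [MochizukiEtTh2009], §4: setting of Definition 4.1 (PDF p.86), Prop 4.2 (iii) p.88 (the data of an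
`N`-th root), Prop 4.3 p.90–91 (bi-Kummer roots).

abc-iut cell, block F (fact-proving wave), seat abc-iut-f-111 (tranche 111, FACT-LIST row F-1305
`BiKummerSetting.Prop43_iii`).  WITNESS DATA FILE in the style of abc-iut-w5-d063's `Toy` / `ToyCov`
(`Discharge/Sec4NonVacuity*.lean`): its `def`s are toy OBJECTS (no `Prop`-valued definition other than the
trivial [FrdI] category vocabulary `catVocab`, exactly as `Toy.catVocab`; no named fact; no instance).  THIS
FILE = part 1 (base category, divisor / rational-function data, the tempered-Frobenioid interface `tf`); the
sequel `Discharge/Sec4GaloisActionToyProp43iii.lean` = part 2 (the §4 setting `S`, the root data, the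
transport homomorphisms, the bi-Kummer root) uses it to REFUTE the universal closure of the typed statement
`Prop43_iii` (kernel countermodel), i.e. to show that the [FrdI] Thm 5.2 (ii) dictionary hypotheses of
abc-iut-L6-t12's `prop43_iii_of` are NOT idle.

THE TOY ("monomials with constants, over a base with a `ℤ`-Galois object and a terminal object"):
* base `D = D₀ := WithTerminal (SingleObj (Multiplicative ℤ))` — two objects: `gen` with
  `Aut(gen) = End(gen) = ℤ` (think: a `ℤ`-covering) and the terminal object `top` (`Aut(top) = 1`), one
  arrow `gen → top`; connected, totally epimorphic;
* `Φ₀ = Φ₀^ℝ = Φ := ℚ_{≥0}` constant (trivial pull-backs) — perfect, `ℚ`-monoprime (so `Φ` IS divisorial);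
* `B₀ = B₀^Λ := ℤ × (ℤ × ℤ)` ("valuation × two constants `(a, b)`"), the generator `t` of `Aut(gen)` acting by
  the SHEAR `(n, a, b) ↦ (n, a, a + b)`, the arrow `gen → top` pulling back by `(n, a, b) ↦ (n, 0, b)`
  (lands in the `t`-invariants, as functoriality demands); divisor map `(n, a, b) ↦ n·𝔭`; `F := B`;
  monoid type `Λ = ℤ`; `ℝ·Φ₀^cnst :=` everything;
* `Π^tp_X ↠ G_K`: abc-iut-w5-d218's inhabitant of `OncePuncturedTemperedGroup ℚ̄` with its surjection
  `Π ↠ ℤ` (`zQuot`); `Π ↠ Aut_D(gen) = ℤ` := `zQuot`, `Π ↠ Aut_D(top) = 1`; every base object Galois;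
* (part 2) the §4 setting `S := BiKummerSetting.mk` with the BIRATIONAL VOCABULARY FREE AND TRIVIAL
  (`O^×(A^birat) := 1`, `fracOf := 1`, trivial `Aut`-action, `DisjointSupports`/`(N,H)`-saturation/
  base-Frobenius-pair slots `:= True`), `A_⊙ := (top, 0)`;
* (part 2) over `A_N = B_N := (gen, 0)`: the base-identity pre-steps `s' := (1, id, 𝔭, (1, 1, 0))`,
  `s'' := (1, id, 𝔭, (1, 0, 0))` (a fraction-pair for `f = 1`), the `1`-st root `R` they form
  (`α = β = id`, `G = 1`), the lift `liftAut : ℤ → Aut_C(A_N)` of `Aut_D(gen)` through the zero section, and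
  the TRANSPORT homomorphisms `transport s : Aut_C(A_N) → Aut_C(B_N)` (`σ ↦` the unique `σ'` with
  `σ' ∘ s = s ∘ σ`; [FrdI] Def 1.3 (iii)(d) for the model, `ModelFrobenioid.exists_iso_comp_eq_of_div_eq` +
  `cancel_left_of_isIso_baseMap`).
So `H_{A_N} = Aut_C(A_N)` (since `H_⊙ = Π`), and the transported sections `s'^{gp} := transport s'`,
`s''^{gp} := transport s''` differ at `liftAut t` by the unit with rational function `t^*x / x`,
`x = u_{s'}/u_{s''} = (0, 1, 0)`, `t^*x/x = (0, 0, 1) ≠ 0` — the sequel turns this into `¬ ∀ S, Prop43_iii`.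
HONEST LIMITS: a consistency/independence toy for the TYPED interfaces (trivial [FrdI] vocabularies, free
birational vocabulary, not a curve); it says nothing about print's Prop 4.3 (iii), whose `f_N`, `κ_f` live
in the genuine `O^×(A^birat)`; no side taken on [IUTchIII] Cor. 3.12; typed ≠ proved.
-/

noncomputable section

namespace Literature.AnabelianGeometry.EtaleTheta

open CategoryTheory Opposite Literature.AlgebraicGeometry.Frobenioids
open scoped NNRat

namespace ToyGal

/-! ## The base category -/

/-- The base `D = D₀`: the one-object groupoid `B(ℤ)` with a terminal object adjoined.
[cite: MochizukiEtTh2009, Def 3.3 p.73] -/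
abbrev Base : Type := WithTerminal (SingleObj (Multiplicative ℤ))

/-- The Galois object `gen` (`Aut(gen) = ℤ`). [cite: MochizukiEtTh2009, Def 4.1 p.87] -/
abbrev gen : Base := WithTerminal.of (SingleObj.star (Multiplicative ℤ))

/-- The terminal object `top` (`Aut(top) = 1`), base of `A_⊙`. [cite: MochizukiEtTh2009, Def 4.1 p.86] -/
abbrev top : Base := WithTerminal.star

/-- The automorphism of `gen` with underlying element `g ∈ ℤ`, as a group homomorphism
`ℤ → Aut_D(gen)` (for any copy `of x` of `gen`). [cite: MochizukiEtTh2009, Def 4.1 p.87] -/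
def autOf (x : SingleObj (Multiplicative ℤ)) : Multiplicative ℤ →* Aut (WithTerminal.of x : Base) where
  toFun g :=
    { hom := (show x ⟶ x from g)
      inv := (show x ⟶ x from (g⁻¹ : Multiplicative ℤ))
      hom_inv_id := by
        change (g⁻¹ * g : Multiplicative ℤ) = 1
        exact inv_mul_cancel g
      inv_hom_id := by
        change (g * g⁻¹ : Multiplicative ℤ) = 1
        exact mul_inv_cancel g }
  map_one' := Iso.ext rfl
  map_mul' g g' := Iso.ext (by
    change (g * g' : Multiplicative ℤ) = g * g'
    rfl)

/-- `autOf` is surjective: every automorphism of `gen` is some `g ∈ ℤ`. [cite: MochizukiEtTh2009, Def 4.1 p.87] -/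
theorem autOf_surjective (x : SingleObj (Multiplicative ℤ)) : Function.Surjective (autOf x) := fun α =>
  ⟨(WithTerminal.down α.hom : x ⟶ x), Iso.ext rfl⟩

/-- `Aut_D(top)` is trivial. [cite: MochizukiEtTh2009, Def 4.1 p.86] -/
theorem aut_top_eq_one (α : Aut (top : Base)) : α = 1 := Iso.ext (Subsingleton.elim _ _)

/-! ## The rational-function group `ℤ × (ℤ × ℤ)` with its shear action -/

/-- `B₀(Y) := ℤ × (ℤ × ℤ)`: a valuation and two "constants" `(a, b)`. [cite: MochizukiEtTh2009, Def 3.3 p.73] -/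
abbrev Bgrp : Type := Multiplicative ℤ × (Multiplicative ℤ × Multiplicative ℤ)

/-- The shear `(n, a, b) ↦ (n, a, k·a + b)`: pull-back along the automorphism `k ∈ ℤ = Aut(gen)`.
[cite: MochizukiEtTh2009, Def 3.3 p.73] -/
def shear (k : Multiplicative ℤ) : Bgrp →* Bgrp where
  toFun x := (x.1, (x.2.1, x.2.1 ^ (Multiplicative.toAdd k) * x.2.2))
  map_one' := by simp
  map_mul' x y := by
    ext <;> simp only [Prod.fst_mul, Prod.snd_mul, mul_zpow]
    rw [mul_mul_mul_comm]

/-- The projection `(n, a, b) ↦ (n, 0, b)`: pull-back along `gen → top` (onto the shear-invariants).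
[cite: MochizukiEtTh2009, Def 3.3 p.73] -/
def proj : Bgrp →* Bgrp where
  toFun x := (x.1, (1, x.2.2))
  map_one' := by simp
  map_mul' x y := by ext <;> simp

/-- `shear 1 = id`. [cite: MochizukiEtTh2009, Def 3.3 p.73] -/
theorem shear_one : shear 1 = MonoidHom.id _ := by
  apply MonoidHom.ext
  intro x
  change (x.1, (x.2.1, x.2.1 ^ (Multiplicative.toAdd (1 : Multiplicative ℤ)) * x.2.2)) = x
  rw [toAdd_one, zpow_zero, one_mul]

/-- `shear (k k') = shear k ∘ shear k'`. [cite: MochizukiEtTh2009, Def 3.3 p.73] -/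
theorem shear_mul (k k' : Multiplicative ℤ) : shear (k * k') = (shear k).comp (shear k') := by
  apply MonoidHom.ext
  intro x
  change (x.1, (x.2.1, x.2.1 ^ (Multiplicative.toAdd (k * k')) * x.2.2)) =
    (x.1, (x.2.1, x.2.1 ^ (Multiplicative.toAdd k) * (x.2.1 ^ (Multiplicative.toAdd k') * x.2.2)))
  rw [toAdd_mul, zpow_add, mul_assoc]

/-- The shear fixes the image of `proj`. [cite: MochizukiEtTh2009, Def 3.3 p.73] -/
theorem shear_comp_proj (k : Multiplicative ℤ) : (shear k).comp proj = proj := by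
  apply MonoidHom.ext
  intro x
  change (x.1, ((1 : Multiplicative ℤ), (1 : Multiplicative ℤ) ^ (Multiplicative.toAdd k) * x.2.2)) = (x.1, (1, x.2.2))
  rw [one_zpow, one_mul]

/-- Pull-back of rational functions along a base morphism (by cases on the two objects).
[cite: MochizukiEtTh2009, Def 3.3 p.73] -/
def Bmap : ∀ {X Y : Base}, (X ⟶ Y) → (Bgrp →* Bgrp)
  | .of _, .of _, f => shear (show Multiplicative ℤ from WithTerminal.down f)
  | .of _, .star, _ => proj
  | .star, .star, _ => MonoidHom.id _
  | .star, .of _, f => (WithTerminal.false_of_from_star f).elim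

/-- `Bmap (𝟙 X) = id`. [cite: MochizukiEtTh2009, Def 3.3 p.73] -/
theorem Bmap_id (X : Base) : Bmap (𝟙 X) = MonoidHom.id _ := by
  cases X with
  | of x => exact shear_one
  | star => rfl

/-- `Bmap (f ≫ g) = Bmap f ∘ Bmap g` (contravariance). [cite: MochizukiEtTh2009, Def 3.3 p.73] -/
theorem Bmap_comp {X Y Z : Base} (f : X ⟶ Y) (g : Y ⟶ Z) : Bmap (f ≫ g) = (Bmap f).comp (Bmap g) := by
  cases X with
  | star =>
    cases Y with
    | of y => exact (WithTerminal.false_of_from_star f).elim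
    | star =>
      cases Z with
      | of z => exact (WithTerminal.false_of_from_star g).elim
      | star => rfl
  | of x =>
    cases Y with
    | star =>
      cases Z with
      | of z => exact (WithTerminal.false_of_from_star g).elim
      | star => rfl
    | of y =>
      cases Z with
      | star => exact (shear_comp_proj _).symm
      | of z =>
        change shear (show Multiplicative ℤ from WithTerminal.down f ≫ WithTerminal.down g) =
          (shear (show Multiplicative ℤ from WithTerminal.down f)).comp
            (shear (show Multiplicative ℤ from WithTerminal.down g))
        rw [← shear_mul, SingleObj.comp_as_mul, mul_comm]

/-- Pull-backs preserve the valuation. [cite: MochizukiEtTh2009, Def 3.3 p.73] -/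
theorem Bmap_fst {X Y : Base} (f : X ⟶ Y) (x : Bgrp) : (Bmap f x).1 = x.1 := by
  cases X with
  | star =>
    cases Y with
    | of y => exact (WithTerminal.false_of_from_star f).elim
    | star => rfl
  | of _ =>
    cases Y with
    | of _ => rfl
    | star => rfl

/-- `B₀ = B₀^Λ` as a monoid on `D` (contravariant functor). [cite: MochizukiEtTh2009, Def 3.3 p.73] -/
def Bfun : Baseᵒᵖ ⥤ CommMonCat.{0} where
  obj _ := CommMonCat.of Bgrp
  map f := CommMonCat.ofHom (Bmap f.unop)
  map_id X := by
    apply CommMonCat.hom_ext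
    rw [CommMonCat.hom_ofHom, CommMonCat.hom_id]
    exact Bmap_id X.unop
  map_comp f g := by
    apply CommMonCat.hom_ext
    rw [CommMonCat.hom_ofHom, CommMonCat.hom_comp, CommMonCat.hom_ofHom, CommMonCat.hom_ofHom]
    exact Bmap_comp g.unop f.unop

/-- The divisor map `(n, a, b) ↦ n·𝔭 ∈ (ℚ_{≥0})^gp`. [cite: MochizukiEtTh2009, Def 3.3 p.73] -/
def divHom : Bgrp →* Algebra.GrothendieckGroup (Multiplicative ℚ≥0) := Toy.divHomQ.comp (MonoidHom.fst _ _)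

/-- `gpMap id = id`, pointwise. [folklore] -/
private theorem gpMap_id_apply'' {M : Type} [CommMonoid M] (x : Algebra.GrothendieckGroup M) :
    gpMap (MonoidHom.id M) x = x :=
  DFunLike.congr_fun (Literature.AlgebraicGeometry.Frobenioids.gpMap_id (M := M)) x

/-! ## Def 3.3 (iii) / 3.6 (i) / 3.6 (ii) data -/

/-- **Def 3.3 (iii) data of the toy**: `Φ₀ = ℚ_{≥0}` (constant), `B₀ = ℤ × (ℤ × ℤ)` with the shear action,
`div₀ (n, a, b) = n·𝔭`, `F₀ = B₀`, everything non-cuspidal. [cite: MochizukiEtTh2009, Def 3.3 p.73] -/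
def divisorMonoids : DivisorMonoids.{0, 0, 0} Base where
  Φ₀ := (Functor.const _).obj (CommMonCat.of (Multiplicative ℚ≥0))
  B₀ := Bfun
  isUnit_B₀ _ b := by
    change IsUnit (M := Bgrp) b
    exact Group.isUnit _
  div₀ _ := divHom
  div₀_natural f b := by
    change divHom (Bmap f.unop b) = gpMap (MonoidHom.id _) (divHom b)
    rw [gpMap_id_apply'']
    change Toy.divHomQ (Bmap f.unop b).1 = Toy.divHomQ b.1
    rw [Bmap_fst]
  F₀ _ := ⊤
  F₀_map _ _ _ := trivial
  ncsp₀ _ := ⊤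
  csp₀ _ := ⊥
  ncsp₀_map _ _ _ := trivial
  csp₀_map _ x hx := by
    rw [Submonoid.mem_bot] at hx ⊢
    rw [hx, map_one]
  existsUnique_ncsp_csp _ x := by
    refine ⟨(⟨x, trivial⟩, ⟨1, Submonoid.mem_bot.mpr rfl⟩), mul_one x, ?_⟩
    rintro ⟨a, c⟩ h
    have hc : c.1 = 1 := Submonoid.mem_bot.mp c.2
    have ha : a.1 = x := by
      have h' : a.1 * c.1 = x := h
      rwa [hc, mul_one] at h'
    exact Prod.ext (Subtype.ext ha) (Subtype.ext hc)

/-- **Def 3.6 (i) data of the toy** (`Λ = ℤ`, `Φ₀^ℝ = Φ₀`, `B₀^Λ = B₀`, `ℝ·Φ₀^cnst =` everything), over the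
trivial monoid vocabulary. [cite: MochizukiEtTh2009, Def 3.6 p.76] -/
def realified : RealifiedDivisorMonoids (D₀ := Base) Toy.monoidVocab where
  toDivisorMonoids := divisorMonoids
  Λ := MonoidType.Z
  ΦR := (Functor.const _).obj (CommMonCat.of (Multiplicative ℚ≥0))
  toR _ := MonoidHom.id _
  toR_natural _ _ := rfl
  isRealification _ := trivial
  BΛ := Bfun
  isUnit_BΛ _ b := by
    change IsUnit (M := Bgrp) b
    exact Group.isUnit _
  divΛ _ := divHom
  divΛ_natural f b := by
    change divHom (Bmap f.unop b) = gpMap (MonoidHom.id _) (divHom b)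
    rw [gpMap_id_apply'']
    change Toy.divHomQ (Bmap f.unop b).1 = Toy.divHomQ b.1
    rw [Bmap_fst]
  FΛ _ := ⊤
  FΛ_map _ _ _ := trivial
  cnstR _ := ⊤
  cnstR_map _ _ _ := trivial
  divΛ_mem_cnstR _ _ _ := trivial
  cnstR_root _ _ _ _ := trivial
  cnst_le_cnstR _ _ _ := trivial
  ncspR _ := ⊤
  cspR _ := ⊥
  toR_ncsp _ _ _ := trivial
  toR_csp _ _ hx := hx

/-- The trivial [FrdI] category vocabulary on the base (every predicate `True`), as `Toy.catVocab`.
[cite: MochizukiEtTh2009, Def 3.6 p.77] -/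
def catVocab : FrdICatStub.{0, 0, 0} Base where
  IsDivisorialOn _ := True
  IsRational _ := True
  IsStrictlyRational _ := True

/-- Every morphism of the base is an epimorphism. [cite: MochizukiEtTh2009, Def 3.6 p.77] -/
theorem epi_base {X Y : Base} (f : X ⟶ Y) : Epi f := by
  cases X with
  | star =>
    cases Y with
    | of y => exact (WithTerminal.false_of_from_star f).elim
    | star =>
      refine ⟨fun {Z} g h _ => ?_⟩
      cases Z with
      | of z => exact (WithTerminal.false_of_from_star g).elim
      | star => exact Subsingleton.elim g h
  | of x =>
    cases Y with
    | of y =>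
      change Epi (WithTerminal.incl.map (WithTerminal.down f))
      infer_instance
    | star =>
      refine ⟨fun {Z} g h _ => ?_⟩
      cases Z with
      | of z => exact (WithTerminal.false_of_from_star g).elim
      | star => exact Subsingleton.elim g h

/-- **Def 3.6 (ii), the toy tempered-Frobenioid interface**: `D = D₀` (connected — `top` is terminal —,
totally epimorphic), `Φ = Φ^{ℝ-log} = ℚ_{≥0}` (group-saturated; `Φ^{bs-fld} = ℚ_{≥0}` monoprime, REAL), and the
constant `(1, 0, 0) ∈ B = F` has divisor `𝔭 ≠ 0` (condition (b), REAL). [cite: MochizukiEtTh2009, Def 3.6 p.77] -/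
def tf : TemperedFrobenioid realified Base catVocab where
  isConnected := zigzag_isConnected fun j₁ j₂ =>
    (Zigzag.of_hom (WithTerminal.starTerminal.from j₁)).trans (Zigzag.of_inv (WithTerminal.starTerminal.from j₂))
  isTotallyEpimorphic := ⟨fun f => epi_base f⟩
  base := 𝟭 _
  Φ := ⟨fun _ => ⊤, fun _ _ _ => trivial⟩
  isGroupSaturated A := (isGroupSaturated_iff' _).2 fun _ _ _ _ _ _ => trivial
  isPerfFactorial _ := trivial
  isDivisorialOn := trivial
  isMonoprime_bsFld A := Toy.isMonoprime_of_eq_top_nnrat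
    (eq_top_iff.2 fun x _ => Submonoid.mem_inf.2 ⟨Submonoid.mem_top x,
      (Subgroup.mem_top (Algebra.GrothendieckGroup.of x) :
        Algebra.GrothendieckGroup.of x ∈
          (⊤ : Subgroup (Algebra.GrothendieckGroup (Multiplicative ℚ≥0))))⟩)
  exists_FΛ_div_ne A := ⟨((Multiplicative.ofAdd (1 : ℤ), ((1 : Multiplicative ℤ), (1 : Multiplicative ℤ))) : Bgrp),
    trivial, (Multiplicative.ofAdd (1 : ℚ≥0) : Multiplicative ℚ≥0), trivial, (1 : Multiplicative ℚ≥0), trivial,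
    fun h => one_ne_zero (Multiplicative.ofAdd.injective h), by
      change Toy.divHomQ (Multiplicative.ofAdd (1 : ℤ)) = _
      rw [Toy.divHomQ_ofAdd_one]
      change Algebra.GrothendieckGroup.of (M := Multiplicative ℚ≥0) (Multiplicative.ofAdd 1) =
        Algebra.GrothendieckGroup.of (M := Multiplicative ℚ≥0) (Multiplicative.ofAdd 1) /
          Algebra.GrothendieckGroup.of (M := Multiplicative ℚ≥0) 1
      rw [(Algebra.GrothendieckGroup.of (M := Multiplicative ℚ≥0)).map_one, div_one]⟩

/-- "monoid type `ℤ`". [cite: MochizukiEtTh2009, Def 4.1 p.86] -/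
theorem tf_monoidType : tf.monoidType = MonoidType.Z := rfl

/-- "`Φ` is perfect": `Φ(A) = ℚ_{≥0}`. [cite: MochizukiEtTh2009, Def 4.1 p.86] -/
theorem tf_isPerfect (A : Baseᵒᵖ) : IsPerfect (tf.Φ.carrier A) :=
  isPerfect_of_mulEquiv_nnrat (N := ↥(⊤ : Submonoid (Multiplicative ℚ≥0))) Submonoid.topEquiv

/-- `Φ = ℚ_{≥0}` is objectwise divisorial (so the [FrdI] Thm 5.2 (ii) lemmas of the tree apply).
[cite: MochizukiEtTh2009, Def 3.6 p.77] -/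
theorem divisorMonoid_isDivisorial : Objectwise (fun M _ => IsDivisorial M) tf.divisorMonoid :=
  fun _ => (Toy.isMonoprime_of_eq_top_nnrat (S := (⊤ : Submonoid (Multiplicative ℚ≥0))) rfl).isDivisorial

/-- `B` is objectwise group-like. [cite: MochizukiEtTh2009, Def 3.6 p.77] -/
theorem ratFnFunctor_isGroupLike : Objectwise (fun M _ => IsGroupLike M) tf.ratFnFunctor :=
  tf.ratFnFunctor_isGroupLike realified.isUnit_BΛ

end ToyGal

end Literature.AnabelianGeometry.EtaleTheta

end
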